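import Summits.CriticalPhenomena.CardyFormulaZ2.Theorems.CardyBoundaryCoulombGasHalfPlaneMarkDensityLawSelfDualityTrap
import Summits.CriticalPhenomena.CardyFormulaZ2.Theorems.CardyBoundaryCoulombGasHalfPlaneMarkDensityLawNonDegeneracy
import Literature.Probability.Percolation.BoxCrossingUpperBound
import Literature.Probability.Percolation.AnnulusCrossingBoundProofs
import Literature.Probability.Percolation.RSWProofs

/-!
# Lead's skeleton (c12-0), wave 2: the macroscopic WINDOW lower bound for the leftmost point and the
# STRICT monotonicity of joint subsequential limits in the fourth mark (crux `HalfPlaneMarkDensityLaw`)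

Target: for `a < b < c < x < y`, with `L_n` the `⌊cn⌋`-most vertex of `[⌊cn⌋,∞)×{0}` joined in `ℤ×ℕ`
to `A_n = [⌊an⌋,⌊bn⌋]×{0}`, `P[⌊xn⌋ < L_n ≤ ⌊yn⌋] = P_n(a,b,c,y) − P_n(a,b,c,x) ≥ c₀ > 0` eventually;
hence every joint subsequential limit `G` of the half-plane four-arc crossing probability is STRICTLY
increasing in its fourth mark.  Construction: a dual "U" (two dual top–bottom crossings of face boxes
over the gap `(b,c)` and over the window `(x,x')`, joined by a dual left–right crossing of a bar) seals
`[⌊cn⌋, ⌊xn⌋]` from `A_n` (trapping lemma `SelfDual.moat_end_trapped`), and a primal arch over it joins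
`A_n` to `[⌊x''n⌋, ⌊yn⌋]`; the two live on disjoint edge sets (independence), each has probability
`≥ const` (RSW, Harris–FKG, the law of the dual configuration `bondPercolation_half_real_preimage_dualConfig`).
-/

noncomputable section

namespace Summit.CriticalPhenomena.CardyFormulaZ2.Cruxes.HalfPlaneMarkDensityLaw.SketchLine

open Literature.Probability.Percolation Literature.Probability.LatticeModels
open MeasureTheory Filter Set SimpleGraph
open scoped Topology
open Summit.CriticalPhenomena.CardyFormulaZ2.Theorems.HalfPlaneMarkDensityLaw.Negative

namespace Window

/-- STUB W1 (deterministic, dual side): a dual U gives a dual face walk from the moat under the left box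
to the moat under the right box, all of whose edges have an endpoint of height `≥ 0`. [folklore] -/
theorem stub_dualU_walk :
    ∀ (ω : BondConfig (Site 2)) (g₁ g₂ r₁ r₂ H' H : ℤ), g₁ ≤ g₂ → g₂ < r₁ → r₁ ≤ r₂ → 0 ≤ H' → H' ≤ H →
      dualConfig ω ∈ openCrossing {z : Site 2 | g₁ ≤ z 0 ∧ z 0 ≤ g₂ ∧ -1 ≤ z 1 ∧ z 1 ≤ H}
        {z : Site 2 | z 1 = -1} {z : Site 2 | z 1 = H} →
      dualConfig ω ∈ openCrossing {z : Site 2 | g₁ ≤ z 0 ∧ z 0 ≤ r₂ ∧ H' ≤ z 1 ∧ z 1 ≤ H}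
        {z : Site 2 | z 0 = g₁} {z : Site 2 | z 0 = r₂} →
      dualConfig ω ∈ openCrossing {z : Site 2 | r₁ ≤ z 0 ∧ z 0 ≤ r₂ ∧ -1 ≤ z 1 ∧ z 1 ≤ H}
        {z : Site 2 | z 1 = -1} {z : Site 2 | z 1 = H} →
      ∃ p₁ p₂ : ℤ, g₁ ≤ p₁ ∧ p₁ ≤ g₂ ∧ r₁ ≤ p₂ ∧ p₂ ≤ r₂ ∧
        ∃ Q : (zdGraph 2).Walk (![p₁, -1] : Site 2) ![p₂, -1],
          (∀ e ∈ Q.edges, e ∈ dualConfig ω) ∧ (∀ z ∈ Q.support, -1 ≤ z 1) ∧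
          (∀ e ∈ Q.edges, ∃ w ∈ e, (0 : ℤ) ≤ w 1) := by
  sorry

/-- STUB W2 (deterministic, sealing): a dual face walk from the moat face `(p₁,-1)` to the moat face
`(p₂,-1)` that never runs along the moat separates, inside `ℤ×ℕ`, every boundary vertex left of `p₁`
(inclusive) from every boundary vertex in `(p₁, p₂]`. [folklore] -/
theorem stub_dualSeal :
    ∀ (ω : BondConfig (Site 2)), ω ⊆ (zdGraph 2).edgeSet → ∀ (p₁ p₂ : ℤ), p₁ < p₂ →
      (∃ Q : (zdGraph 2).Walk (![p₁, -1] : Site 2) ![p₂, -1],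
          (∀ e ∈ Q.edges, e ∈ dualConfig ω) ∧ (∀ z ∈ Q.support, -1 ≤ z 1) ∧
          (∀ e ∈ Q.edges, ∃ w ∈ e, (0 : ℤ) ≤ w 1)) →
      ∀ (u v : Site 2), u 1 = 0 → v 1 = 0 → u 0 ≤ p₁ → p₁ < v 0 → v 0 ≤ p₂ →
        ω ∉ openConnIn halfPlane u v := by
  sorry

/-- STUB W3 (probability, dual side): the dual U at scale `n` has probability `≥ c₀ > 0` eventually. [folklore] -/
theorem stub_dualU_prob :
    ∀ (g₁ g₂ r₁ r₂ h' h : ℝ), g₁ < g₂ → g₂ < r₁ → r₁ < r₂ → 0 < h' → h' < h →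
      ∃ c₀ : ℝ, 0 < c₀ ∧ ∀ᶠ n : ℕ in atTop,
        c₀ ≤ μ.real (dualConfig ⁻¹' (
          openCrossing {z : Site 2 | ⌊g₁ * n⌋ ≤ z 0 ∧ z 0 ≤ ⌊g₂ * n⌋ ∧ -1 ≤ z 1 ∧ z 1 ≤ ⌊h * n⌋}
            {z : Site 2 | z 1 = -1} {z : Site 2 | z 1 = ⌊h * n⌋} ∩
          openCrossing {z : Site 2 | ⌊g₁ * n⌋ ≤ z 0 ∧ z 0 ≤ ⌊r₂ * n⌋ ∧ ⌊h' * n⌋ ≤ z 1 ∧ z 1 ≤ ⌊h * n⌋}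
            {z : Site 2 | z 0 = ⌊g₁ * n⌋} {z : Site 2 | z 0 = ⌊r₂ * n⌋} ∩
          openCrossing {z : Site 2 | ⌊r₁ * n⌋ ≤ z 0 ∧ z 0 ≤ ⌊r₂ * n⌋ ∧ -1 ≤ z 1 ∧ z 1 ≤ ⌊h * n⌋}
            {z : Site 2 | z 1 = -1} {z : Site 2 | z 1 = ⌊h * n⌋})) := by
  sorry

/-- STUB W4 (primal arch): with probability `≥ c₁ > 0` eventually, the source arc `A_n` is joined to the
boundary window `[⌊x''n⌋, ⌊yn⌋]` inside the arch-shaped tube (left column over `A_n` up to height `3H`,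
bar at heights `[2H, 3H]`, right column over the window), `H = ⌊hn⌋`. [folklore] -/
theorem stub_primalArch :
    ∀ (a b x'' y h : ℝ), a < b → b < x'' → x'' < y → 0 < h →
      ∃ c₁ : ℝ, 0 < c₁ ∧ ∀ᶠ n : ℕ in atTop,
        c₁ ≤ μ.real (openCrossing
          ({v : Site 2 | ⌊a * n⌋ ≤ v 0 ∧ v 0 ≤ ⌊b * n⌋ ∧ 0 ≤ v 1 ∧ v 1 ≤ 3 * ⌊h * n⌋} ∪
           {v : Site 2 | ⌊a * n⌋ ≤ v 0 ∧ v 0 ≤ ⌊y * n⌋ ∧ 2 * ⌊h * n⌋ ≤ v 1 ∧ v 1 ≤ 3 * ⌊h * n⌋} ∪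
           {v : Site 2 | ⌊x'' * n⌋ ≤ v 0 ∧ v 0 ≤ ⌊y * n⌋ ∧ 0 ≤ v 1 ∧ v 1 ≤ 3 * ⌊h * n⌋})
          (arcA a b n) (rowIcc ⌊x'' * n⌋ ⌊y * n⌋)) := by
  sorry

/-- STUB W5 (locality helper): the dual edge of any pair shares a site with it — the lower-left endpoint
of a lattice edge, or the pair itself on non-edges. [folklore] -/
theorem stub_dualEdge_shares :
    ∀ e : Sym2 (Site 2), ∃ w ∈ dualEdge e, w ∈ e := by
  sorry

/-- STUB W6 (lead, assembly): **the macroscopic window lower bound** — for `a < b < c < x < y`,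
`P[⌊xn⌋ < L_n ≤ ⌊yn⌋] = P_n(a,b,c,y) − P_n(a,b,c,x) ≥ c₀ > 0` eventually. [folklore] -/
theorem stub_windowLowerBound :
    ∀ (a b c x y : ℝ), a < b → b < c → c < x → x < y →
      ∃ c₀ : ℝ, 0 < c₀ ∧ ∀ᶠ n : ℕ in atTop,
        c₀ ≤ μ.real (openCrossing halfPlane (arcA a b n) (rowIcc ⌊c * n⌋ ⌊y * n⌋) \
          openCrossing halfPlane (arcA a b n) (rowIcc ⌊c * n⌋ ⌊x * n⌋)) := by
  sorry

/-- STUB W7 (lead, corollary): **every joint subsequential limit is STRICTLY increasing in the fourth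
mark.** [folklore] -/
theorem stub_jointLimit_strictMono :
    ∀ {θ : ℕ → ℕ} {G : ℝ → ℝ → ℝ → ℝ → ℝ},
      (∀ a b c y : ℝ, a < b → b < c → c < y →
        Tendsto (fun n ↦ μ.real (openCrossing halfPlane (arcA a b (θ n))
          (rowIcc ⌊c * (θ n : ℕ)⌋ ⌊y * (θ n : ℕ)⌋))) atTop (𝓝 (G a b c y))) →
      StrictMono θ → ∀ {a b c x y : ℝ}, a < b → b < c → c < x → x < y → G a b c x < G a b c y := by
  sorry

end Window

end Summit.CriticalPhenomena.CardyFormulaZ2.Cruxes.HalfPlaneMarkDensityLaw.SketchLine
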